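import Summits.FinalStateConjecture.FinalStateConjecture.Theorems.BartnikGapSettlingGapExhaustionMultiplierBeyondShellUniformOf
import Summits.FinalStateConjecture.FinalStateConjecture.Theorems.BartnikGapSettlingGapExhaustionCylindersExactMarginOutUniform
import HarnessLib

/-!
# `KerrMultiplierBeyondShellUniform`: the time-uniform multiplier form BEYOND the photon shell,
# UNIFORMLY over a compact set of subextremal labels `ℓ = (M, a)`
(crux `GapExhaustion`, stmt-FinalStateConjecture-10808, line photon-shell-pseudoconvexity;
stub (UU-out) `stub_kerrMultiplierBeyondShellU`, the label-uniform twin of the per-label brick (U-out)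
`stub_kerrMultiplierBeyondShell`; lead c11, label-uniformity wave 3 (S3), composition)

The registered inward Killing sweep S3 quantifies its constants BEFORE the Kerr label `(M, a)`
over a compact window of subextremal labels. This file composes the two landed label-uniform
bricks of the multiplier form of the strong pseudo-convexity, for their OUTER side, of the
cylinders `{r = c}` beyond the photon shell (Ionescu–Klainerman, JAMS 26 (2013), Lemma 2.11 (b);
condition (po3) of Ionescu–Klainerman, Invent. Math. 175 (2009), Definition 3.1, for `f = c − r`):
* (UB-out) `stub_kerrCylindersExactMarginOutU` — ONE exact-Kerr Hessian margin `m > 0`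
  (`m‖w‖² ≤ Hess r(w,w)` on the null vectors tangent to the cylinders) for all labels of a
  compact `K ⊆ {0 < M, |a| < M}` and all band points `r_lo(ℓ) ≤ r ≤ r_e(ℓ)`,
  `r_ph⁻(ℓ) < r_lo(ℓ) < r_e(ℓ)`, `r_lo`, `r_e` continuous on `K`;
* (UU-of-out) `stub_kerrMultiplierBeyondShellU_of_margin` — from such a uniform margin, ONE
  pair `(δ, ε₁)` such that every `δ`-close (in `C²` sup norm on the band) chart carries the
  outer multiplier form with constant `ε₁` at every band point, for every label of `K`.
The conclusion is the statement of the per-label brick with `∃ δ ε₁` moved in front of the label;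
`r₊ < r_lo` follows from `r_ph⁻ ≥ 3M > 2M ≥ r₊`.

References: A. D. Ionescu, S. Klainerman, Invent. Math. 175 (2009), Definition 3.1; JAMS 26 (2013),
Lemma 2.11 [IonescuKlainerman2013]; R. P. Kerr, A. Schild (1965), §§2–3 [KerrSchild1965].
-/

noncomputable section

-- instance search through the nested operator types `E4 →L[ℝ] E4 →L[ℝ] E4 →L[ℝ] ℝ`
set_option maxSynthPendingDepth 3

-- D-0017: single-problem summit, `Summit.<S>.<S>.…` by design (cf. lakefile `weak.linter.dupNamespace`).
set_option linter.dupNamespace false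

namespace Summit.FinalStateConjecture.FinalStateConjecture.Theorems

open Set Literature.Geometry.Lorentzian Literature.Geometry.Lorentzian.MetricCoord
open scoped Manifold ContDiff Topology ENNReal

/-- **Stub (UU-out) of the line `photon-shell-pseudoconvexity` (crux `GapExhaustion`,
stmt-FinalStateConjecture-10808) — the time-uniform OUTER multiplier form of the strong
pseudo-convexity of the Kerr cylinders beyond the photon shell, `C²`-stable, UNIFORMLY over a
compact set of subextremal labels.** For a compact `K ⊆ {(M, a) | 0 < M, |a| < M}` and band radii
`r_lo, r_e` continuous on `K` with `r_ph⁻(ℓ) < r_lo(ℓ) < r_e(ℓ)` there are `δ, ε₁ > 0` such that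
for every `ℓ ∈ K`, every spacetime chart on `{ℓ.1 < r}` whose pulled-back components are
`δ`-close in `C²` sup norm to `g_ℓ` on the band, and every band point `z` (all times), some `μ`,
`|μ| ≤ ε₁⁻¹`, satisfies `ε₁²‖w‖² ≤ μ (Φ^*g)_z(w,w) + Hess r_z(w,w) + ε₁⁻² dr_z(w)²` for all `w`
(Ionescu–Klainerman's condition (po3) for `f = c − r`). Composition of (UB-out) and (UU-of-out).
[cite: IonescuKlainerman2013, Lemma 2.11] -/
theorem stub_kerrMultiplierBeyondShellU :
    ∀ (K : Set (ℝ × ℝ)) (r_lo r_e : ℝ × ℝ → ℝ), IsCompact K →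
      (∀ ℓ ∈ K, 0 < ℓ.1 ∧ |ℓ.2| < ℓ.1) → ContinuousOn r_lo K → ContinuousOn r_e K →
      (∀ ℓ ∈ K, Kerr.photonOrbitRadius ℓ.1 |ℓ.2| < r_lo ℓ ∧ r_lo ℓ < r_e ℓ) →
      ∃ (δ ε₁ : ℝ), 0 < δ ∧ 0 < ε₁ ∧ ∀ ℓ ∈ K,
      ∀ (𝓢 : Spacetime.{0} 4) (Φ : E4 → 𝓢.carrier),
        ContMDiffOn 𝓘(ℝ, E4) (𝓡 4) ∞ Φ {z | ℓ.1 < Kerr.radius ℓ.2 z} →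
        Topology.IsOpenEmbedding ({z : E4 | ℓ.1 < Kerr.radius ℓ.2 z}.restrict Φ) →
        supCkENorm {z | ℓ.1 < Kerr.radius ℓ.2 z ∧ r_lo ℓ ≤ Kerr.radius ℓ.2 z ∧ Kerr.radius ℓ.2 z ≤ r_e ℓ} 2
            (fun z => 𝓢.metricInCoords Φ z - Kerr.bilin ℓ.1 ℓ.2 z) ≤ ENNReal.ofReal δ →
        ∀ z : E4, r_lo ℓ ≤ Kerr.radius ℓ.2 z → Kerr.radius ℓ.2 z ≤ r_e ℓ →
          ∃ μ : ℝ, |μ| ≤ ε₁⁻¹ ∧ ∀ w : E4,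
            ε₁ ^ 2 * ‖w‖ ^ 2 ≤ μ * 𝓢.metricInCoords Φ z w w
              + hessAt (𝓢.metricInCoords Φ) (Kerr.radius ℓ.2) z w w
              + ε₁⁻¹ ^ 2 * (fderiv ℝ (Kerr.radius ℓ.2) z w) ^ 2 := by
  intro K r_lo r_e hK hlab hloc hrec hband
  obtain ⟨m, hm, hmargin⟩ := stub_kerrCylindersExactMarginOutU K r_lo r_e hK hlab hloc hrec hband
  -- `r₊(ℓ) ≤ 2 ℓ.1 < 3 ℓ.1 ≤ r_ph⁻(ℓ) < r_lo ℓ`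
  have hrp : ∀ ℓ ∈ K, Kerr.rPlus ℓ.1 ℓ.2 < r_lo ℓ := by
    intro ℓ hℓ
    have hM : 0 < ℓ.1 := (hlab ℓ hℓ).1
    have h3 : 3 * ℓ.1 ≤ Kerr.photonOrbitRadius ℓ.1 |ℓ.2| :=
      (Kerr.photonOrbitRadius_mem hM (abs_nonneg _)).1
    have hsq : √(ℓ.1 ^ 2 - ℓ.2 ^ 2) ≤ ℓ.1 := by
      refine Real.sqrt_le_iff.2 ⟨hM.le, ?_⟩
      nlinarith [sq_nonneg ℓ.2]
    have hrp2 : Kerr.rPlus ℓ.1 ℓ.2 ≤ 2 * ℓ.1 := by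
      unfold Kerr.rPlus; linarith
    linarith [(hband ℓ hℓ).1]
  exact stub_kerrMultiplierBeyondShellU_of_margin K r_lo r_e m hK hlab hloc hrec hrp hm hmargin

end Summit.FinalStateConjecture.FinalStateConjecture.Theorems

end
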